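import Summits.HodgeConjecture.HodgeConjecture.Theorems.K2E1bU21KStringSpan             -- ★ αᵤ-2c part 1: `𝔨` through the five units; the string span
import Summits.HodgeConjecture.HodgeConjecture.Theorems.K2E1bGKStableOfLieStable         -- ★ αᵤ-5a′: `ρK_apply_mem_of_lieStable`, graph trick `map_ρK_of_lie_comm_on`
import Summits.HodgeConjecture.HodgeConjecture.Theorems.K2E1bU21KTypeMultiplicityOne     -- ★ αᵤ-2b: `finrank_intertwiningMap_le_one_of_isCohUnitaryIrrep`
import Literature.RepresentationTheory.BorelWallach2000.UpqMaximalCompactExp             -- ★ `upq_exists_expK_eq` (`K = exp 𝔨` for `U(α, β)`)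
import HarnessLib

/-!
# K2 ∕ E1b — αᵤ road row 2c «HIGHEST-WEIGHT LINES»: `dim hwSpace w ≤ 1` for coh-unitary irreducible `(𝔤, K)`-modules of `U(2,1)`

Cell hodgecm-mathlib, Track B «K2-LIT», engine E1b, unit U8; crux item h413 = stmt-HodgeConjecture-24833 (supports-only helper; closes nothing by itself).
Row αᵤ-2c of K2E1b-plan (g4), DEALT 2026-09-04T04:16:02Z (M2 «2b → hwSpace bridge») and 04:17:23Z («TYPE αᵤ-2c's HEAD TOKEN-PARALLEL TO p10's `hmult`»)
to the desk K2-defs1 (g3).  THEOREMS ONLY — no `def`, no `sorry`, no axiom, no instance declaration (one `attribute [local instance] LieRing.ofAssociativeRing`),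
no notation.

## The head (token-parallel to the hypothesis `hmult` of αᵤ-4a `exists_normalForm_family`, K2E4-p10 (g3))

`hwLines_of_isCohUnitaryIrrep (r : GKIrrep G21) (hr : IsCohUnitaryIrrep r.ρK r.ρ𝔤) : ∀ w, ∃ g ∈ hwSpace r.ρ𝔤 w, ∀ y ∈ hwSpace r.ρ𝔤 w, ∃ c : ℂ, y = c • g`.

## The proof ([Kovacevic2021, §3 Remark 1 — ASSUMED there: «the dimension of the space spanned by the vectors `v¹_{nm}` is 1», p0005 L83]; here PROVED)

§3 (inside a `(𝔤, K)`-module, ★ `IsGKModule`).  For `0 ≠ g ∈ hwSpace w` the string terminates (★ αᵤ-2a `exists_string_length` in the finite-dimensional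
`K`-span ★ `kFinite`, `f`-stable by ★ `apply_mem_of_K_stable_of_mem_kInLie`): `n − 1 = m`, `f^{m+1} g = 0 ≠ f^k g` (`k ≤ m`), and `f^{m+1}` kills every
`y ∈ hwSpace w` (same weight ⇒ same length) — `exists_string_of_mem_hwSpace`.  The string span `S` is stable under the five units (part 1), hence `𝔨`-stable,
hence `K`-STABLE by ★ αᵤ-5a′ `IsGKModule.ρK_apply_mem_of_lieStable` with ★ `upq_exists_expK_eq` (`string_K_stable`); the `K`-representation `τ` on `S`
(Mathlib `Representation.subrepresentation`) is IRREDUCIBLE (`isIrreducible_string`: a `K`-stable `X ≠ 0` inside `S` is `𝔨`-stable, so `e`,`f`-stable; `e`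
is nilpotent on `S`, so `X ∋ x₁ ≠ 0` with `e x₁ = 0`; `ker e ∩ S = ℂ g`, so `g ∈ X`, so `S ⊆ X`).  For `y ∈ hwSpace w` the string-matching linear map
`f^k g ↦ f^k y` (Mathlib `Basis.constr` on `Basis.span`, extended by `LinearMap.exists_extend`) commutes with the five units on `S` (weights; the `e`-string
formula with the SAME `m`; `f^{m+1} y = 0`), hence with `𝔨`, hence with `K` by the GRAPH TRICK ★ `IsGKModule.map_ρK_of_lie_comm_on`: an element
`ψ_y ∈ Hom_K(τ, r)` with `ψ_y g = y` (`exists_intertwiningMap_apply_eq`).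
§4 HEAD.  `Hom_K(τ, r)` has dimension `≤ 1` (★ αᵤ-2b `finrank_intertwiningMap_le_one_of_isCohUnitaryIrrep` — Gelfand's trick through the unitary
globalization), so the inclusion `ι` and `ψ_y` are proportional to one `v₀` (Mathlib `finrank_le_one_iff`); evaluating at `g`: `y = c • g`.

Sources: [Kovacevic2021, §3 Def. 1, Remark 1]; [Kraljevic1973 (multiplicity one of K-types for SU(n,1))]; [KnappVogan1995, §I.4 (1.64)–(1.65), §IV.1].

HONEST LABEL: kernel theorems about `(𝔤, K)`-modules of `U(2,1)`; a helper of the 8b-αᵤ road (it pays the `hmult` input of αᵤ-4a by name), it closes no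
socket by itself.  HC_CM is proved only modulo the 7 printed citations (2 remaining named inputs: hLiu418 = stmt-HodgeConjecture-24832,
h413 = stmt-HodgeConjecture-24833) until rung 0 closes.
-/

-- Mathlib idiom (as in ★ `GKModules` and every `(𝔤, K)` file of the tree): the commutator bracket on `Module.End ℂ V` ∕ matrices, needed to MENTION
-- `r.ρ𝔤 : G21.lie →ₗ⁅ℝ⁆ Module.End ℂ r.V` (`LieRing.ofAssociativeRing` is a `def` in Mathlib).
attribute [local instance 100] LieRing.ofAssociativeRing

set_option autoImplicit false
set_option linter.dupNamespace false

noncomputable section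

open Module
open Literature.RepresentationTheory Literature.RepresentationTheory.BorelWallach2000
open Literature.RepresentationTheory.KonnoKonno2007 Literature.RepresentationTheory.KonnoKonno2007.RealDualPair
open Literature.NumberTheory.Automorphic
open Summit.HodgeConjecture.HodgeConjecture.Cruxes.H413.F0P3bLocalAPacketsDefs (G21)
open Summit.HodgeConjecture.HodgeConjecture.Cruxes.H413.F0P3bArchDegOnePackage (IsCohUnitaryIrrep)
open Summit.HodgeConjecture.HodgeConjecture.Cruxes.H413.K2E1bU21Weights
open Summit.HodgeConjecture.HodgeConjecture.Cruxes.H413.K2E1bU21KTypeStrings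
open Summit.HodgeConjecture.HodgeConjecture.Cruxes.H413.K2E1bU21KTypeMultiplicityOne

namespace Summit.HodgeConjecture.HodgeConjecture.Cruxes.H413.K2E1bU21HwLines

variable {V : Type*} [AddCommGroup V] [Module ℂ V]
  {ρK : Representation ℂ G21.maximalCompact V} {ρ𝔤 : G21.lie →ₗ⁅ℝ⁆ Module.End ℂ V}

/-! ## §3 Strings inside a `(𝔤, K)`-module: termination, `K`-stability (★ 5a′), `K`-irreducibility -/

section GK

variable (hV : IsGKModule G21 ρK ρ𝔤)
include hV

/-- **The string of a highest-weight vector terminates at the K-type dimension**: for `0 ≠ g ∈ hwSpace w` there is `m` with `n − 1 = m`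
(`n = labelN w`), `f^{m+1} g = 0`, `f^k g ≠ 0` (`k ≤ m`) — and `f^{m+1}` kills EVERY `y ∈ hwSpace w` (same weight, same length).
★ `exists_string_length` inside the finite-dimensional `K`-span (★ `kFinite`, `f`-stable by ★ `u21_kInLie_apply_mem_of_K_stable`).
[cite: Kovacevic2021, §3 Def. 1] [cite: KnappVogan1995, §IV.1] -/
theorem exists_string_of_mem_hwSpace {w : Fin 2 ⊕ Fin 1 → ℤ} {g : V} (hg : g ∈ hwSpace ρ𝔤 w) (hg0 : g ≠ 0) :
    ∃ m : ℕ, ((labelN w - 1 : ℤ) : ℂ) = m ∧ (u21f ρ𝔤 ^ (m + 1)) g = 0 ∧ (∀ k ≤ m, (u21f ρ𝔤 ^ k) g ≠ 0) ∧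
      ∀ y ∈ hwSpace ρ𝔤 w, (u21f ρ𝔤 ^ (m + 1)) y = 0 := by
  -- the string of any `0 ≠ v ∈ hwSpace w` has length `n` with `n − 1 = labelN w − 1`
  have main : ∀ v ∈ hwSpace ρ𝔤 w, v ≠ 0 → ∃ n : ℕ, 0 < n ∧ ((labelN w - 1 : ℤ) : ℂ) = (n : ℂ) - 1 ∧ (u21f ρ𝔤 ^ n) v = 0 ∧
      ∀ k < n, (u21f ρ𝔤 ^ k) v ≠ 0 := by
    intro v hv hv0
    rw [mem_hwSpace_iff] at hv
    haveI : FiniteDimensional ℂ (Submodule.span ℂ (Set.range fun k : G21.maximalCompact => ρK k v)) := hV.kFinite v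
    have hFk : ∀ Y ∈ G21.kInLie, ∀ u ∈ Submodule.span ℂ (Set.range fun k : G21.maximalCompact => ρK k v), ρ𝔤 Y u ∈
        Submodule.span ℂ (Set.range fun k : G21.maximalCompact => ρK k v) :=
      fun Y hY u hu => apply_mem_of_K_stable_of_mem_kInLie ρK hV (fun k u hu => GKWeights.kSpan_stable v k hu) hY hu
    exact exists_string_length ρ𝔤 (fun u hu => u21f_apply_mem ρ𝔤 hFk hu) (GKWeights.mem_kSpan v) hv0 (u21h_apply_of_mem_wtSpace' ρ𝔤 hv.1) hv.2
  obtain ⟨n, hn, hμ, htop, hne⟩ := main g hg hg0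
  obtain ⟨m, rfl⟩ : ∃ m, n = m + 1 := ⟨n - 1, by omega⟩
  refine ⟨m, by rw [hμ]; push_cast; ring, htop, fun k hk => hne k (by omega), fun y hy => ?_⟩
  by_cases hy0 : y = 0
  · rw [hy0, map_zero]
  obtain ⟨n', -, hμ', htop', -⟩ := main y hy hy0
  have hnn : (m + 1 : ℕ) = n' := Nat.cast_injective (R := ℂ) (sub_left_injective (hμ.symm.trans hμ'))
  rw [hnn]; exact htop'

variable {w : Fin 2 ⊕ Fin 1 → ℤ} {g : V} {m : ℕ}

/-- **The string span is `K`-stable** — it is stable under the five block-diagonal units (§2), hence under `𝔨` (§1), hence under `K = exp 𝔨`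
(★ `IsGKModule.ρK_apply_mem_of_lieStable`, ★ `upq_exists_expK_eq`). [cite: KnappVogan1995, §I.4 (1.64)–(1.65), §IV.1] -/
theorem string_K_stable (hg : g ∈ hwSpace ρ𝔤 w) (hm : ((labelN w - 1 : ℤ) : ℂ) = m) (htop : (u21f ρ𝔤 ^ (m + 1)) g = 0) :
    ∀ (k : G21.maximalCompact), ∀ u ∈ Submodule.span ℂ (Set.range fun i : Fin (m + 1) => (u21f ρ𝔤 ^ (i : ℕ)) g),
      ρK k u ∈ Submodule.span ℂ (Set.range fun i : Fin (m + 1) => (u21f ρ𝔤 ^ (i : ℕ)) g) :=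
  hV.ρK_apply_mem_of_lieStable upq_exists_expK_eq
    (compactLie_apply_mem_of_units ρ𝔤 (string_units_stable ρ𝔤 hg hm htop) (string_unit₂₂_stable ρ𝔤 hg))

/-- **The string span is an IRREDUCIBLE `K`-representation.**  A `K`-stable subspace `X ≠ 0` of it is `𝔨`-stable (★ `u21_kInLie_apply_mem_of_K_stable`),
so `e`- and `f`-stable; `e` is nilpotent on the string, so `X ∩ ker e ≠ 0`; but `ker e` on the string is `ℂ g` (§2), so `g ∈ X` and then every
`f^k g ∈ X`. [cite: KnappVogan1995, §IV.1] [cite: Kovacevic2021, §3 Def. 1] -/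
theorem isIrreducible_string (hg : g ∈ hwSpace ρ𝔤 w) (hg0 : g ≠ 0) (hm : ((labelN w - 1 : ℤ) : ℂ) = m)
    (hne : ∀ k ≤ m, (u21f ρ𝔤 ^ k) g ≠ 0)
    (hS : ∀ k : G21.maximalCompact, Submodule.span ℂ (Set.range fun i : Fin (m + 1) => (u21f ρ𝔤 ^ (i : ℕ)) g) ≤
      (Submodule.span ℂ (Set.range fun i : Fin (m + 1) => (u21f ρ𝔤 ^ (i : ℕ)) g)).comap (ρK k)) :
    (ρK.subrepresentation _ hS).IsIrreducible := by
  have hgS : g ∈ Submodule.span ℂ (Set.range fun i : Fin (m + 1) => (u21f ρ𝔤 ^ (i : ℕ)) g) :=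
    Submodule.subset_span ⟨0, by simp only [Fin.val_zero, pow_zero, Module.End.one_apply]⟩
  set S : Submodule ℂ V := Submodule.span ℂ (Set.range fun i : Fin (m + 1) => (u21f ρ𝔤 ^ (i : ℕ)) g) with hSdef
  set τ := ρK.subrepresentation S hS with hτ
  haveI : Nontrivial (Subrepresentation τ) := by
    refine ⟨⟨⊥, ⊤, fun h => hg0 ?_⟩⟩
    have hmem : (⟨g, hgS⟩ : S) ∈ (⊤ : Subrepresentation τ).toSubmodule := trivial
    rw [← h] at hmem
    exact congrArg Subtype.val ((Submodule.mem_bot ℂ).mp hmem)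
  refine ⟨fun W' => ?_⟩
  -- the image `X ⊆ V` of `W'`
  let X : Submodule ℂ V := W'.toSubmodule.map S.subtype
  have hXS : X ≤ S := Submodule.map_subtype_le S _
  have hXK : ∀ (k : G21.maximalCompact), ∀ u ∈ X, ρK k u ∈ X := by
    rintro k _ ⟨x, hx, rfl⟩
    exact ⟨τ k x, W'.apply_mem_toSubmodule k hx, rfl⟩
  have hXk : ∀ Y ∈ G21.kInLie, ∀ u ∈ X, ρ𝔤 Y u ∈ X := fun Y hY u hu => apply_mem_of_K_stable_of_mem_kInLie ρK hV hXK hY hu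
  have hXe : ∀ u ∈ X, u21e ρ𝔤 u ∈ X := fun u hu => u21e_apply_mem ρ𝔤 hXk hu
  have hXf : ∀ u ∈ X, u21f ρ𝔤 u ∈ X := fun u hu => u21f_apply_mem ρ𝔤 hXk hu
  by_cases hX0 : ∀ x ∈ X, x = 0
  · -- `X = 0`, so `W' = ⊥`
    left
    refine Subrepresentation.toSubmodule_injective ((Submodule.eq_bot_iff _).mpr fun x hx => ?_)
    exact Subtype.ext (hX0 _ ⟨x, hx, rfl⟩)
  · -- `X ≠ 0`: a primitive vector of `X`
    right
    push Not at hX0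
    obtain ⟨x, hxX, hx0⟩ := hX0
    have hex : ∃ j : ℕ, (u21e ρ𝔤 ^ j) x = 0 := ⟨m + 1, u21e_pow_apply_eq_zero ρ𝔤 hg hm (hXS hxX)⟩
    classical
    have hj0 : Nat.find hex ≠ 0 := by
      intro h0
      have h1 := Nat.find_spec hex
      rw [h0, pow_zero, Module.End.one_apply] at h1
      exact hx0 h1
    set x₁ : V := (u21e ρ𝔤 ^ (Nat.find hex - 1)) x with hx₁
    have hx₁0 : x₁ ≠ 0 := Nat.find_min hex (by omega)
    have hx₁e : u21e ρ𝔤 x₁ = 0 := by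
      rw [hx₁, ← Module.End.mul_apply, ← pow_succ', Nat.sub_add_cancel (by omega)]
      exact Nat.find_spec hex
    have hpowX : ∀ (j : ℕ), ∀ u ∈ X, (u21e ρ𝔤 ^ j) u ∈ X := by
      intro j
      induction j with
      | zero => intro u hu; simpa only [pow_zero, Module.End.one_apply] using hu
      | succ j ih => intro u hu; rw [pow_succ', Module.End.mul_apply]; exact hXe _ (ih u hu)
    have hx₁X : x₁ ∈ X := hpowX _ x hxX
    -- `x₁ = c • g` with `c ≠ 0`, so `g ∈ X`
    obtain ⟨c, hc⟩ := exists_eq_smul_of_u21e_eq_zero ρ𝔤 hg hm hne (hXS hx₁X) hx₁e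
    have hc0 : c ≠ 0 := by rintro rfl; exact hx₁0 (by rw [hc, zero_smul])
    have hgX : g ∈ X := by
      have h := X.smul_mem c⁻¹ hx₁X
      rwa [hc, smul_smul, inv_mul_cancel₀ hc0, one_smul] at h
    -- every `f^k g ∈ X`, so `S ≤ X`
    have hfpow : ∀ k : ℕ, (u21f ρ𝔤 ^ k) g ∈ X := by
      intro k
      induction k with
      | zero => simpa only [pow_zero, Module.End.one_apply] using hgX
      | succ k ih => rw [pow_succ', Module.End.mul_apply]; exact hXf _ ih
    have hSX : S ≤ X := Submodule.span_le.mpr (Set.range_subset_iff.mpr fun i => hfpow i)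
    refine Subrepresentation.toSubmodule_injective (Submodule.eq_top_iff'.mpr fun x => ?_)
    obtain ⟨y, hy, hyx⟩ := hSX x.2
    rw [← Subtype.ext hyx]
    exact hy

/-- **The `K`-intertwiners `f^k g ↦ f^k y` (`y ∈ hwSpace w`)**: a linear map on the string span of `g` with these values commutes with the five units
(weights, the string formula for `e` with the SAME weight `m`, `f^{m+1} y = 0`), hence with `𝔨` (§1), hence with `K` by the GRAPH TRICK ★
`IsGKModule.map_ρK_of_lie_comm_on`; so there is `ψ ∈ Hom_K(string, V)` with `ψ g = y`. [cite: KnappVogan1995, §I.4 (1.64)–(1.65), §IV.1] -/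
theorem exists_intertwiningMap_apply_eq (hg : g ∈ hwSpace ρ𝔤 w) (hm : ((labelN w - 1 : ℤ) : ℂ) = m)
    (htop : (u21f ρ𝔤 ^ (m + 1)) g = 0) (hne : ∀ k ≤ m, (u21f ρ𝔤 ^ k) g ≠ 0)
    (hS : ∀ k : G21.maximalCompact, Submodule.span ℂ (Set.range fun i : Fin (m + 1) => (u21f ρ𝔤 ^ (i : ℕ)) g) ≤
      (Submodule.span ℂ (Set.range fun i : Fin (m + 1) => (u21f ρ𝔤 ^ (i : ℕ)) g)).comap (ρK k))
    {y : V} (hy : y ∈ hwSpace ρ𝔤 w) (hytop : (u21f ρ𝔤 ^ (m + 1)) y = 0)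
    (hgS : g ∈ Submodule.span ℂ (Set.range fun i : Fin (m + 1) => (u21f ρ𝔤 ^ (i : ℕ)) g)) :
    ∃ ψ : (ρK.subrepresentation _ hS).IntertwiningMap ρK, ψ ⟨g, hgS⟩ = y := by
  set b : Fin (m + 1) → V := fun i => (u21f ρ𝔤 ^ (i : ℕ)) g with hb
  set S : Submodule ℂ V := Submodule.span ℂ (Set.range b) with hSdef
  have hg' := (mem_hwSpace_iff ρ𝔤 _ _).1 hg
  have hy' := (mem_hwSpace_iff ρ𝔤 _ _).1 hy
  have hμg := u21h_apply_eq_natCast_smul ρ𝔤 hm hg'.1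
  have hμy := u21h_apply_eq_natCast_smul ρ𝔤 hm hy'.1
  -- the linear map `φ : S → V`, `f^k g ↦ f^k y`, extended to `Φ : V → V`
  have hli := linearIndependent_string ρ𝔤 hμg hne
  let B := Basis.span hli
  let φ : S →ₗ[ℂ] V := B.constr ℂ fun i => (u21f ρ𝔤 ^ (i : ℕ)) y
  obtain ⟨Φ, hΦ⟩ := LinearMap.exists_extend φ
  have hΦb : ∀ i : Fin (m + 1), Φ (b i) = (u21f ρ𝔤 ^ (i : ℕ)) y := by
    intro i
    have h1 : Φ (b i) = φ (B i) := by
      rw [Basis.span_apply, ← hΦ, LinearMap.comp_apply, Submodule.subtype_apply]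
    rw [h1, Basis.constr_basis]
  -- `Φ` commutes with the five units on `S` (checked on the spanning string)
  have hdiag : ∀ j : Fin 2 ⊕ Fin 1, ∀ u ∈ S, Φ (upqLieC ρ𝔤 (Matrix.single j j (1 : ℂ)) u) = upqLieC ρ𝔤 (Matrix.single j j (1 : ℂ)) (Φ u) := by
    intro j u hu
    refine LinearMap.eqOn_span (f := Φ ∘ₗ upqLieC ρ𝔤 (Matrix.single j j (1 : ℂ))) (g := upqLieC ρ𝔤 (Matrix.single j j (1 : ℂ)) ∘ₗ Φ) ?_ hu
    rintro _ ⟨i, rfl⟩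
    change Φ (upqLieC ρ𝔤 (Matrix.single j j 1) (b i)) = upqLieC ρ𝔤 (Matrix.single j j 1) (Φ (b i))
    rw [(mem_wtSpace_iff ρ𝔤 _ _).1 (u21f_pow_apply_mem_wtSpace ρ𝔤 hg'.1 (i : ℕ)) j, map_smul, hΦb,
      (mem_wtSpace_iff ρ𝔤 _ _).1 (u21f_pow_apply_mem_wtSpace ρ𝔤 hy'.1 (i : ℕ)) j]
  have he : ∀ u ∈ S, Φ (u21e ρ𝔤 u) = u21e ρ𝔤 (Φ u) := by
    intro u hu
    refine LinearMap.eqOn_span (f := Φ ∘ₗ u21e ρ𝔤) (g := u21e ρ𝔤 ∘ₗ Φ) ?_ hu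
    rintro _ ⟨i, rfl⟩
    change Φ (u21e ρ𝔤 (b i)) = u21e ρ𝔤 (Φ (b i))
    rw [hΦb]
    rcases i with ⟨_ | k, hk⟩
    · change Φ (u21e ρ𝔤 ((u21f ρ𝔤 ^ 0) g)) = u21e ρ𝔤 ((u21f ρ𝔤 ^ 0) y)
      rw [pow_zero, Module.End.one_apply, Module.End.one_apply, hg'.2, hy'.2, map_zero]
    · change Φ (u21e ρ𝔤 ((u21f ρ𝔤 ^ (k + 1)) g)) = u21e ρ𝔤 ((u21f ρ𝔤 ^ (k + 1)) y)
      rw [u21e_apply_u21f_pow_succ_apply ρ𝔤 hμg hg'.2 k, u21e_apply_u21f_pow_succ_apply ρ𝔤 hμy hy'.2 k, map_smul]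
      exact congrArg _ (hΦb ⟨k, by omega⟩)
  have hf : ∀ u ∈ S, Φ (u21f ρ𝔤 u) = u21f ρ𝔤 (Φ u) := by
    intro u hu
    refine LinearMap.eqOn_span (f := Φ ∘ₗ u21f ρ𝔤) (g := u21f ρ𝔤 ∘ₗ Φ) ?_ hu
    rintro _ ⟨i, rfl⟩
    change Φ (u21f ρ𝔤 ((u21f ρ𝔤 ^ (i : ℕ)) g)) = u21f ρ𝔤 (Φ (b i))
    rw [hΦb, ← Module.End.mul_apply (u21f ρ𝔤) (u21f ρ𝔤 ^ (i : ℕ)) g, ← pow_succ',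
      ← Module.End.mul_apply (u21f ρ𝔤) (u21f ρ𝔤 ^ (i : ℕ)) y, ← pow_succ']
    by_cases hi : (i : ℕ) + 1 ≤ m
    · exact hΦb ⟨(i : ℕ) + 1, by omega⟩
    · have : (i : ℕ) + 1 = m + 1 := by omega
      rw [this, htop, hytop, map_zero]
  have h₁ : ∀ (a c : Fin 2), ∀ u ∈ S, Φ (upqLieC ρ𝔤 (Matrix.single (Sum.inl a) (Sum.inl c) (1 : ℂ)) u) =
      upqLieC ρ𝔤 (Matrix.single (Sum.inl a) (Sum.inl c) (1 : ℂ)) (Φ u) := by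
    intro a c u hu
    by_cases hac : a = c
    · subst hac; exact hdiag _ u hu
    have key : ∀ a c : Fin 2, a ≠ c → (a = 0 ∧ c = 1) ∨ (a = 1 ∧ c = 0) := by decide
    obtain ⟨rfl, rfl⟩ | ⟨rfl, rfl⟩ := key a c hac
    · rw [← u21e_eq]; exact he u hu
    · rw [← u21f_eq]; exact hf u hu
  -- the graph trick: `Φ` is `K`-equivariant on `S`
  have hK : ∀ (k : G21.maximalCompact), ∀ u ∈ S, Φ (ρK k u) = ρK k (Φ u) := fun k u hu =>
    hV.map_ρK_of_lie_comm_on hV upq_exists_expK_eq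
      (compactLie_apply_mem_of_units ρ𝔤 (string_units_stable ρ𝔤 hg hm htop) (string_unit₂₂_stable ρ𝔤 hg)) Φ
      (map_compactLie_apply_of_units ρ𝔤 ρ𝔤 Φ h₁ (fun u hu => hdiag _ u hu)) k hu
  refine ⟨{ toLinearMap := Φ ∘ₗ S.subtype, isIntertwining' := fun k => LinearMap.ext fun u => hK k u u.2 }, ?_⟩
  change Φ g = y
  have h0 := hΦb 0
  simp only [hb, Fin.val_zero, pow_zero, Module.End.one_apply] at h0
  exact h0

end GK

/-! ## §4 THE HEAD: highest-weight lines of coh-unitary irreducible `(𝔤, K)`-modules of `U(2,1)` -/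

/-- **`dim hwSpace w ≤ 1` FOR A COH-UNITARY IRREDUCIBLE `(𝔤, K)`-MODULE OF `U(2,1)`** — in the «lines» shape token-parallel to the hypothesis `hmult` of
αᵤ-4a `exists_normalForm_family`: every `y ∈ hwSpace w` is a multiple of one `g`.  PROOF: if `0 ≠ g ∈ hwSpace w`, its `𝔨`-string span `S` is a
`K`-stable (§3, ★ 5a′) irreducible (§3) finite-dimensional `K`-representation `τ`; the inclusion `ι` and, for `y ∈ hwSpace w`, the string-matching
map `ψ_y : f^k g ↦ f^k y` (§3, `K`-equivariant by the graph trick) are elements of `Hom_K(τ, r)`, which has dimension `≤ 1` (★ p857241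
`finrank_intertwiningMap_le_one_of_isCohUnitaryIrrep`: Gelfand's trick through the unitary globalization); so `ψ_y = c ι` up to the scalar of `ι`,
and evaluating at `g`: `y = c • g`.  (Kovačević ASSUMES this — «the dimension of the space spanned by the vectors `v¹_{nm}` is 1», §3 p0005 L83;
here it is PROVED for the coh-unitary irreducibles.) [cite: Kovacevic2021, §3 Remark 1] [cite: Kraljevic1973, Thm. (multiplicity one for SU(n,1))]
[cite: KnappVogan1995, §IV.1] -/
theorem hwLines_of_isCohUnitaryIrrep (r : GKIrrep G21) (hr : IsCohUnitaryIrrep r.ρK r.ρ𝔤) :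
    ∀ w, ∃ g ∈ hwSpace r.ρ𝔤 w, ∀ y ∈ hwSpace r.ρ𝔤 w, ∃ c : ℂ, y = c • g := by
  intro w
  by_cases h0 : ∀ g ∈ hwSpace r.ρ𝔤 w, g = 0
  · exact ⟨0, zero_mem _, fun y hy => ⟨0, by rw [h0 y hy, zero_smul]⟩⟩
  push Not at h0
  obtain ⟨g, hg, hg0⟩ := h0
  refine ⟨g, hg, fun y hy => ?_⟩
  have hV : IsGKModule G21 r.ρK r.ρ𝔤 := r.isGKModule
  obtain ⟨m, hm, htop, hne, hall⟩ := exists_string_of_mem_hwSpace hV hg hg0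
  -- the string span `S`, a `K`-stable irreducible finite-dimensional `K`-representation `τ`
  have hS : ∀ k : G21.maximalCompact, Submodule.span ℂ (Set.range fun i : Fin (m + 1) => (u21f r.ρ𝔤 ^ (i : ℕ)) g) ≤
      (Submodule.span ℂ (Set.range fun i : Fin (m + 1) => (u21f r.ρ𝔤 ^ (i : ℕ)) g)).comap (r.ρK k) :=
    fun k u hu => string_K_stable hV hg hm htop k u hu
  have hgS : g ∈ Submodule.span ℂ (Set.range fun i : Fin (m + 1) => (u21f r.ρ𝔤 ^ (i : ℕ)) g) :=
    Submodule.subset_span ⟨0, by simp only [Fin.val_zero, pow_zero, Module.End.one_apply]⟩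
  haveI : FiniteDimensional ℂ (Submodule.span ℂ (Set.range fun i : Fin (m + 1) => (u21f r.ρ𝔤 ^ (i : ℕ)) g)) :=
    FiniteDimensional.span_of_finite ℂ (Set.finite_range _)
  have hτ := isIrreducible_string hV hg hg0 hm hne hS
  obtain ⟨hfin, hle⟩ := finrank_intertwiningMap_le_one_of_isCohUnitaryIrrep r hr (r.ρK.subrepresentation _ hS) hτ
  -- `ι` and `ψ_y` in the (at most) one-dimensional `Hom_K(τ, r)`
  let ι : (r.ρK.subrepresentation _ hS).IntertwiningMap r.ρK :=
    { toLinearMap := Submodule.subtype _, isIntertwining' := fun k => LinearMap.ext fun u => rfl }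
  obtain ⟨ψ, hψ⟩ := exists_intertwiningMap_apply_eq hV hg hm htop hne hS hy (hall y hy) hgS
  obtain ⟨v₀, hv₀⟩ := finrank_le_one_iff.mp hle
  obtain ⟨c₁, hc₁⟩ := hv₀ ι
  obtain ⟨c₂, hc₂⟩ := hv₀ ψ
  have e₁ : c₁ • v₀ ⟨g, hgS⟩ = g := by
    rw [← Representation.IntertwiningMap.smul_apply, hc₁]; rfl
  have e₂ : c₂ • v₀ ⟨g, hgS⟩ = y := by
    rw [← Representation.IntertwiningMap.smul_apply, hc₂, hψ]
  have hc₁0 : c₁ ≠ 0 := by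
    rintro rfl
    rw [zero_smul] at e₁
    exact hg0 e₁.symm
  refine ⟨c₂ * c₁⁻¹, ?_⟩
  calc y = c₂ • v₀ ⟨g, hgS⟩ := e₂.symm
    _ = (c₂ * c₁⁻¹) • (c₁ • v₀ ⟨g, hgS⟩) := by rw [smul_smul, mul_assoc, inv_mul_cancel₀ hc₁0, mul_one]
    _ = (c₂ * c₁⁻¹) • g := by rw [e₁]

end Summit.HodgeConjecture.HodgeConjecture.Cruxes.H413.K2E1bU21HwLines

end
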